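import Literature.AnabelianGeometry.AbsoluteAnabelian.MonoidKummerGaloisCyclotomeRestrictionWitness
import Literature.AnabelianGeometry.AbsoluteAnabelian.MonoidKummerGaloisCyclotomeJunctionBridge
import HarnessLib

/-!
# [AbsTopIII] Prop 3.3 (i) clause (c) along the RESTRICTION MORPHISMS of Def 3.1 (ii): THE junctions
# `Λ(k̄ˣ) ≃* μ_Ẑ(G_k)` and THE presented `TLG` classes intertwine `Λ(φ_M)` with the group-theoretic `μ_Ẑ(β)`

S. Mochizuki, *Topics in Absolute Anabelian Geometry III*, §3 (bib key `MochizukiAbsTopIII2015`; kurims manuscript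
`paper:url-5493eb38cbb7`): Def. 3.1 (ii) p. 67 (a morphism of MLF-Galois `T`-pairs «induces an open injective
homomorphism between the respective arithmetic Galois groups» — basic example: the restriction to a finite
extension `k′/k` inside `k̄`), Prop. 3.3 (i) p. 73 («functorial algorithms» for the Kummer maps; «the natural
isomorphism `μ_Ẑ(M) ⥲ μ_Ẑ(G)` [cf. Remark 3.2.1] is only determined up to a `{±1}`- (respectively, `Ẑ^×`-) multiple
if `T = TLG` (respectively, `T = TCG`)»), Rmk. 3.2.1 / 3.2.2 p. 73, Cor. 1.10 (i) p. 42 (functoriality «with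
respect to arbitrary injective open homomorphisms»), Rmk. 1.10.1 (iii) p. 44 (the index correction); [AbsAnab]
Prop. 1.2.1 (vi)/(vii) pp. 10–11 («by the Verlagerung»; bib key `MochizukiAbsAnab2004`).

abc-iut cell, layer L4, node AbsTopIII:Prop3.3(i) — row «P33i-FUND-RESTRICTION» (seat abc-iut-w4-d009 gen 6;
L4-lead GO m34 (d)).  PROOF-ONLY (no `def`, no new `Prop` fact).  State of the tree for clause (c), `T = TLG`:
THE class of a presented pair is natural along ISOMORPHISMS of pairs (across base fields, up to the
group-theoretic `μ_Ẑ(ᾱ)`: `TLGPresentation.unitKummerTheoryMuZhatFund_cycIsoClass_of_tmIso` p446102,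
`…_cycIsoClass_indep` p447609).  This file does the NON-INVERTIBLE morphisms of Def. 3.1 (ii) of restriction
type, consuming abc-iut-L4-t2's coefficient square for THE reciprocity data along restriction morphisms
(`GaloisMonoidPair.Hom.coeffSquare_restrict`, which rests on abc-iut-L4-t11's
`Cor110Open.fundamental_equiv_restrict_compat`) BY NAME:

* §1 `GaloisMonoidPair.Hom.cyclotomeUnitsEquivMuZhatFund_symm_muZhatMap` /
  `…cyclotomeUnitsEquivMuZhatFund_map_restrict` — for a restriction morphism
  `φ : (Π₁ ↷ 𝒪_Ē^⊳) → (Π₂ ↷ 𝒪_F̄^⊳)` along `j : Ē ≃_F F̄` of model `TM`-pairs (`E/F` finite, open augmentations),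
  THE junctions of `(E, Ē)` and `(F, F̄)` intertwine `Λ(j) : Λ(Ēˣ) → Λ(F̄ˣ)` with the GROUP-THEORETIC
  `μ_Ẑ(β) : μ_Ẑ(G_E) ⥲ μ_Ẑ(G_F)` of the covered open injection `β` (index-corrected, Rmk. 1.10.1 (iii)):
  `junction_F (Λ(j) ξ) = μ_Ẑ(β) (junction_E ξ)`;
* §2 `GaloisMonoidPair.TLGPresentation.cyclotomeNonZeroDivisorsEquiv_cyclotomeCongr_homM` — for ABSTRACT
  MLF-Galois `TLG`-pairs `P`, `Q` with presentations `π` (by `(E, Ē)`), `ϖ` (by `(F, F̄)`) and a morphism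
  `f : P → Q` whose transition map `ϖ⁻¹ ∘ f_M ∘ π` on `Ē^× → F̄^×` is `j` (hypothesis `hM`): `Λ(f_M)` read in the
  models is `Λ(j)`;
* §4 `cyclotomeUnitsEquivMuZhatFund_map_restrictHom` — the HYPOTHESIS-FREE GENUINE instance of §1 at the
  restriction morphism `restrictHom F E : (G_E ↷ 𝒪_Ē^⊳) → (G_F ↷ 𝒪_F̄^⊳)` of the Galois models on Mathlib's
  algebraic closures (`MonoidKummerGaloisCyclotomeRestrictionWitness.lean`), for every finite extension `E/F` of
  `p`-adic fields: THE junctions of `(E, E^alg)` and `(F, F^alg)` intertwine `Λ(ι⁻¹)` with `μ_Ẑ(res)`;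
* §3 **`GaloisMonoidPair.TLGPresentation.unitKummerTheoryMuZhatFund_cycIsoClass_restrict`** (and the converse
  `…_restrict'`, and the version for THE canonical members `…_canonical_restrict`): for every member `e₁` of THE
  class of `π` there is a member `e₂` of THE class of `ϖ` with `e₂ ∘ Λ(f_M) = μ_Ẑ(β) ∘ e₁` on `μ_Ẑ(M_P)`, and
  conversely — Prop. 3.3 (i) clause (c) is compatible with the restriction morphisms of `𝒞^MLF_TLG`, the
  identification of the targets being the group-theoretic `μ_Ẑ(β)` of Cor. 1.10 (i).

READING (honest scope): together with the isomorphism case (p446102/p447609) and abc-iut-L4-d3's factorisation of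
an arbitrary injective open `β` as `Inn(g) ∘ res ∘ iso` (`OpenInjectionFactorsThroughRestriction.lean`) this is
print's «functorial» for (i)(c) on the morphisms of Def. 3.1 (ii) whose monoid component is a restriction/iso;
it is NOT available for every morphism of `𝒞^MLF_TLG` — along the power endomorphism `(𝟙_Π, x ↦ x²)` the map
`Λ(φ_M)` is multiplication by `2`, which no `{±1}`-twist absorbs (abc-iut-L4-t2's finding E-L4-10,
`kummerMuZhat_powEnd_ne`, for the `TM` analogue).  The `TCG` twin carries no datum (every identification is in
the class, `UnitKummerTheory.mem_cycIsoClass_of_TCG`) and is not restated.  OUR kernel theorems about OUR typing of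
refereed pre-IUT material (local class field theory + Kummer theory at the model objects); nothing here bears on
[IUTchIII] Cor. 3.12; no side is taken; nothing asserts that abc is proved or refuted.
-/

noncomputable section

open scoped nonZeroDivisors

namespace Literature.AnabelianGeometry.AbsoluteAnabelian

open Field

/-! ### §1 THE junctions along a restriction morphism of model pairs -/

namespace GaloisMonoidPair.Hom

variable {C₁ C₂ : MLFClosure.{0}} [Algebra C₂.k C₁.k] [FiniteDimensional C₂.k C₁.k]
  [Algebra C₂.k C₁.K] [IsScalarTower C₂.k C₁.k C₁.K]
  (j : C₁.K ≃ₐ[C₂.k] C₂.K)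
  {D₁ : ModelMLFGaloisData C₁.k C₁.K} {D₂ : ModelMLFGaloisData C₂.k C₂.K}
  (φ : GaloisMonoidPair.Hom D₁.tmPair D₂.tmPair)
  (haug : ∀ (g : D₁.Pi) (x : C₁.K), D₂.aug (φ.homPi g) (j x) = j (D₁.aug g x))
  (hφM : ∀ m : nonzeroIntegers C₁.k C₁.K, ((φ.homM m : nonzeroIntegers C₂.k C₂.K) : C₂.K) = j (m : C₁.K))
  [ValuativeExtension C₂.k C₁.k]

include haug hφM in
/-- **THE junctions inverted intertwine `μ_Ẑ(β)` with `Λ(j)`** along a restriction morphism `φ` of model `TM`-pairs: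
`junction_F⁻¹ (μ_Ẑ(β) η) = Λ(j) (junction_E⁻¹ η)` for `η ∈ μ_Ẑ(G_E)` — abc-iut-L4-t2's coefficient square for THE
data (`coeffSquare_restrict`, «by the Verlagerung») read through the shared junction name
(`MLFClosure.cyclotomeUnitsEquivMuZhatFund_symm_apply`: THE junction inverted is `Λ(rootsHom C (fundamental k))`).
[cite: MochizukiAbsTopIII2015, Remark 3.2.1 p.73] [cite: MochizukiAbsAnab2004, Prop 1.2.1 (vii) p.11] -/
theorem cyclotomeUnitsEquivMuZhatFund_symm_muZhatMap (h₁ : IsOpenMap D₁.aug) (h₂ : IsOpenMap D₂.aug)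
    (η : muZhat (absoluteGaloisGroup C₁.k)) :
    C₂.cyclotomeUnitsEquivMuZhatFund.symm (φ.muZhatMap h₁ h₂ η) =
      EtaleTheta.cyclotome.map (Units.map (j : C₁.K →* C₂.K)) (C₁.cyclotomeUnitsEquivMuZhatFund.symm η) := by
  rw [MLFClosure.cyclotomeUnitsEquivMuZhatFund_symm_apply, MLFClosure.cyclotomeUnitsEquivMuZhatFund_symm_apply,
    φ.coeffSquare_restrict j haug hφM h₁ h₂, φ.unitsLift_eq_of_restrict j hφM]

include haug hφM in
/-- **THE junctions intertwine `Λ(j)` with the group-theoretic `μ_Ẑ(β)`**: for a restriction morphism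
`φ : (Π₁ ↷ 𝒪_Ē^⊳) → (Π₂ ↷ 𝒪_F̄^⊳)` along `j : Ē ≃_F F̄` (finite `E/F`, open augmentations) and `ξ ∈ Λ(Ēˣ)`,
`junction_F (Λ(j) ξ) = μ_Ẑ(β) (junction_E ξ)`, `β : G_E ↪ G_F` the open injection covered by `φ_Π` and `μ_Ẑ(β)`
its index-corrected group-theoretic action on cyclotomes (Cor. 1.10 (i), Rmk. 1.10.1 (iii)) — the cyclotome slots
of THE presented unit Kummer theories are functorial along restriction morphisms via `μ_Ẑ(β)`.
[cite: MochizukiAbsTopIII2015, Proposition 3.3 (i) p.73] [cite: MochizukiAbsTopIII2015, Remark 1.10.1 p.44] -/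
theorem cyclotomeUnitsEquivMuZhatFund_map_restrict (h₁ : IsOpenMap D₁.aug) (h₂ : IsOpenMap D₂.aug)
    (ξ : EtaleTheta.cyclotome (C₁.K)ˣ) :
    C₂.cyclotomeUnitsEquivMuZhatFund (EtaleTheta.cyclotome.map (Units.map (j : C₁.K →* C₂.K)) ξ) =
      φ.muZhatMap h₁ h₂ (C₁.cyclotomeUnitsEquivMuZhatFund ξ) := by
  obtain ⟨η, rfl⟩ : ∃ η, C₁.cyclotomeUnitsEquivMuZhatFund.symm η = ξ :=
    ⟨C₁.cyclotomeUnitsEquivMuZhatFund ξ, MulEquiv.symm_apply_apply _ ξ⟩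
  rw [MulEquiv.apply_symm_apply, ← φ.cyclotomeUnitsEquivMuZhatFund_symm_muZhatMap j haug hφM h₁ h₂,
    MulEquiv.apply_symm_apply]

end GaloisMonoidPair.Hom

/-! ### §2 Presented `TLG`-pairs: `Λ(f_M)` read in the models is `Λ(j)` -/

namespace GaloisMonoidPair.TLGPresentation

variable {P Q : GaloisMonoidPair.{0}} (f : GaloisMonoidPair.Hom P Q) (π : P.TLGPresentation) (ϖ : Q.TLGPresentation)
  [Algebra ϖ.C.k π.C.K] (j : π.C.K ≃ₐ[ϖ.C.k] ϖ.C.K)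
  (hM : ∀ x : (π.C.K)⁰, ((ϖ.iso.isoM.symm (f.homM (π.iso.isoM x)) : (ϖ.C.K)⁰) : ϖ.C.K) = j (x : π.C.K))

/-- THE canonical member of THE class of a presentation `π` by `(k, k̄)`: `μ_Ẑ(M) ⥲ μ_Ẑ(k̄^×) ⥲ Λ(k̄ˣ) ⥲ μ_Ẑ(G_k)`
(through `π`, the cyclotome of the model `TLG`-pair, and THE junction).
[cite: MochizukiAbsTopIII2015, Proposition 3.3 (i) p.73] -/
theorem trans_cyclotomeUnitsEquivMuZhatFund_mem_cycIsoClass :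
    ((MonoidKummerTheory.cyclotomeCongr π.iso.isoM.symm).trans π.C.cyclotomeNonZeroDivisorsEquiv).trans
        π.C.cyclotomeUnitsEquivMuZhatFund ∈ π.unitKummerTheoryMuZhatFund.cycIsoClass :=
  ⟨(MonoidKummerTheory.cyclotomeCongr π.iso.isoM.symm).trans π.C.cyclotomeNonZeroDivisorsEquiv,
    ⟨π.C.cyclotomeNonZeroDivisorsEquiv, Or.inl rfl, rfl⟩, rfl⟩

/-- … and its inverse-twisted companion `μ_Ẑ(M) ⥲^{(·)⁻¹} μ_Ẑ(M) ⥲ μ_Ẑ(G_k)` is the other member.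
[cite: MochizukiAbsTopIII2015, Proposition 3.3 (i) p.73] -/
theorem inv_trans_cyclotomeUnitsEquivMuZhatFund_mem_cycIsoClass :
    ((MulEquiv.inv (cyclotome P.M)).trans
        (((MonoidKummerTheory.cyclotomeCongr π.iso.isoM.symm).trans π.C.cyclotomeNonZeroDivisorsEquiv).trans
          π.C.cyclotomeUnitsEquivMuZhatFund)) ∈ π.unitKummerTheoryMuZhatFund.cycIsoClass := by
  obtain ⟨e₂, he₂, hcomp⟩ := π.unitKummerTheoryMuZhatFund.cycIsoClass_full _
    π.trans_cyclotomeUnitsEquivMuZhatFund_mem_cycIsoClass (MulEquiv.inv (cyclotome P.M)) (fun _ => Or.inr rfl)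
  have heq : e₂ = (MulEquiv.inv (cyclotome P.M)).trans
      (((MonoidKummerTheory.cyclotomeCongr π.iso.isoM.symm).trans π.C.cyclotomeNonZeroDivisorsEquiv).trans
        π.C.cyclotomeUnitsEquivMuZhatFund) :=
    MulEquiv.ext fun ζ => hcomp ζ
  exact heq ▸ he₂

include hM in
/-- **`Λ(f_M)` read in the models is `Λ(j)`**: for a morphism `f : P → Q` of presented `TLG`-pairs whose
transition map `ϖ_M⁻¹ ∘ f_M ∘ π_M : Ē^× → F̄^×` is `j` on elements (hypothesis `hM` — the restriction morphisms),
`Λ-units_F (μ_Ẑ(ϖ_M⁻¹) (Λ(f_M) ζ)) = Λ(j) (Λ-units_E (μ_Ẑ(π_M⁻¹) ζ))` for `ζ ∈ μ_Ẑ(M_P)`.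
[cite: MochizukiAbsTopIII2015, Definition 3.1 (v) p.69] -/
theorem cyclotomeNonZeroDivisorsEquiv_cyclotomeCongr_homM (ζ : cyclotome P.M) :
    ϖ.C.cyclotomeNonZeroDivisorsEquiv (MonoidKummerTheory.cyclotomeCongr ϖ.iso.isoM.symm
        (EtaleTheta.cyclotome.map (Units.map f.homM) ζ)) =
      EtaleTheta.cyclotome.map (Units.map (j : π.C.K →* ϖ.C.K))
        (π.C.cyclotomeNonZeroDivisorsEquiv (MonoidKummerTheory.cyclotomeCongr π.iso.isoM.symm ζ)) := by
  refine Subtype.ext (funext fun n => Units.ext ?_)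
  have hx : (((ζ : ℕ+ → (P.M)ˣ) n : (P.M)ˣ) : P.M) =
      π.iso.isoM (π.iso.isoM.symm (((ζ : ℕ+ → (P.M)ˣ) n : (P.M)ˣ) : P.M)) :=
    (MulEquiv.apply_symm_apply _ _).symm
  calc ((((ϖ.C.cyclotomeNonZeroDivisorsEquiv (MonoidKummerTheory.cyclotomeCongr ϖ.iso.isoM.symm
          (EtaleTheta.cyclotome.map (Units.map f.homM) ζ)) : EtaleTheta.cyclotome (ϖ.C.K)ˣ) :
            ℕ+ → (ϖ.C.K)ˣ) n : (ϖ.C.K)ˣ) : ϖ.C.K)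
        = ((ϖ.iso.isoM.symm (f.homM (((ζ : ℕ+ → (P.M)ˣ) n : (P.M)ˣ) : P.M)) : (ϖ.C.K)⁰) : ϖ.C.K) := rfl
    _ = ((ϖ.iso.isoM.symm (f.homM (π.iso.isoM
          (π.iso.isoM.symm (((ζ : ℕ+ → (P.M)ˣ) n : (P.M)ˣ) : P.M)))) : (ϖ.C.K)⁰) : ϖ.C.K) := by rw [← hx]
    _ = j ((π.iso.isoM.symm (((ζ : ℕ+ → (P.M)ˣ) n : (P.M)ˣ) : P.M) : (π.C.K)⁰) : π.C.K) := hM _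
    _ = ((((EtaleTheta.cyclotome.map (Units.map (j : π.C.K →* ϖ.C.K))
          (π.C.cyclotomeNonZeroDivisorsEquiv (MonoidKummerTheory.cyclotomeCongr π.iso.isoM.symm ζ)) :
            EtaleTheta.cyclotome (ϖ.C.K)ˣ) : ℕ+ → (ϖ.C.K)ˣ) n : (ϖ.C.K)ˣ) : ϖ.C.K) := rfl

/-! ### §3 THE presented `TLG` classes along a restriction morphism -/

variable [Algebra ϖ.C.k π.C.k] [FiniteDimensional ϖ.C.k π.C.k] [IsScalarTower ϖ.C.k π.C.k π.C.K]
  [ValuativeExtension ϖ.C.k π.C.k]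
  (φ : GaloisMonoidPair.Hom π.D.tmPair ϖ.D.tmPair)
  (haug : ∀ (g : π.D.Pi) (x : π.C.K), ϖ.D.aug (φ.homPi g) (j x) = j (π.D.aug g x))
  (hφM : ∀ m : nonzeroIntegers π.C.k π.C.K, ((φ.homM m : nonzeroIntegers ϖ.C.k ϖ.C.K) : ϖ.C.K) = j (m : π.C.K))

include hM haug hφM in
/-- **THE canonical members intertwine on the nose**: for a morphism `f : P → Q` of presented `TLG`-pairs whose
transition pair on the models is the groupified restriction morphism `φ` along `j : Ē ≃_F F̄` (`hM`), THE canonical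
member `E_Q : μ_Ẑ(M_Q) ⥲ μ_Ẑ(G_F)` of the class of `ϖ` and `E_P : μ_Ẑ(M_P) ⥲ μ_Ẑ(G_E)` of the class of `π` satisfy
`E_Q (Λ(f_M) ζ) = μ_Ẑ(β) (E_P ζ)`. [cite: MochizukiAbsTopIII2015, Proposition 3.3 (i) p.73] -/
theorem cyclotomeUnitsEquivMuZhatFund_canonical_restrict (h₁ : IsOpenMap π.D.aug) (h₂ : IsOpenMap ϖ.D.aug)
    (ζ : cyclotome P.M) :
    (((MonoidKummerTheory.cyclotomeCongr ϖ.iso.isoM.symm).trans ϖ.C.cyclotomeNonZeroDivisorsEquiv).trans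
        ϖ.C.cyclotomeUnitsEquivMuZhatFund) (EtaleTheta.cyclotome.map (Units.map f.homM) ζ) =
      φ.muZhatMap h₁ h₂ ((((MonoidKummerTheory.cyclotomeCongr π.iso.isoM.symm).trans
        π.C.cyclotomeNonZeroDivisorsEquiv).trans π.C.cyclotomeUnitsEquivMuZhatFund) ζ) := by
  rw [MulEquiv.trans_apply, MulEquiv.trans_apply, MulEquiv.trans_apply, MulEquiv.trans_apply,
    cyclotomeNonZeroDivisorsEquiv_cyclotomeCongr_homM f π ϖ j hM,
    GaloisMonoidPair.Hom.cyclotomeUnitsEquivMuZhatFund_map_restrict j φ haug hφM h₁ h₂]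

include hM haug hφM in
/-- **[AbsTopIII] Prop 3.3 (i) clause (c), `T = TLG`, along the RESTRICTION MORPHISMS of Def 3.1 (ii).**  For
abstract MLF-Galois `TLG`-pairs `P`, `Q` presented by `(E, Ē)`, `(F, F̄)` (`E/F` finite) and a morphism `f : P → Q`
whose transition pair on the models is the groupified restriction morphism `φ` along `j : Ē ≃_F F̄`: for every
member `e₁` of THE class of identifications `μ_Ẑ(M_P) ⥲ μ_Ẑ(G_E)` there is a member `e₂` of THE class
`μ_Ẑ(M_Q) ⥲ μ_Ẑ(G_F)` with `e₂ ∘ Λ(f_M) = μ_Ẑ(β) ∘ e₁`, `μ_Ẑ(β)` the GROUP-THEORETIC (index-corrected) action of the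
covered open injection `β : G_E ↪ G_F` on the cyclotomes of Cor. 1.10 (i): «the natural isomorphism
`μ_Ẑ(M) ⥲ μ_Ẑ(G)` … determined up to a `{±1}`-multiple» is compatible with restriction.
[cite: MochizukiAbsTopIII2015, Proposition 3.3 (i) p.73] [cite: MochizukiAbsTopIII2015, Remark 1.10.1 p.44] -/
theorem unitKummerTheoryMuZhatFund_cycIsoClass_restrict (h₁ : IsOpenMap π.D.aug) (h₂ : IsOpenMap ϖ.D.aug) :
    ∀ e₁ ∈ π.unitKummerTheoryMuZhatFund.cycIsoClass, ∃ e₂ ∈ ϖ.unitKummerTheoryMuZhatFund.cycIsoClass,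
      ∀ ζ : cyclotome P.M,
        e₂ (EtaleTheta.cyclotome.map (Units.map f.homM) ζ) = φ.muZhatMap h₁ h₂ (e₁ ζ) := by
  intro e₁ he₁
  -- `e₁ = E_P ∘ u` with `u ∈ {𝟙, (·)⁻¹}`
  obtain ⟨u, hu, hcomp⟩ := π.unitKummerTheoryMuZhatFund.cycIsoClass_torsor _
    π.trans_cyclotomeUnitsEquivMuZhatFund_mem_cycIsoClass e₁ he₁
  rcases hu rfl with rfl | rfl
  · refine ⟨_, ϖ.trans_cyclotomeUnitsEquivMuZhatFund_mem_cycIsoClass, fun ζ => ?_⟩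
    rw [hcomp, MulEquiv.refl_apply]
    exact cyclotomeUnitsEquivMuZhatFund_canonical_restrict f π ϖ j hM φ haug hφM h₁ h₂ ζ
  · refine ⟨_, ϖ.inv_trans_cyclotomeUnitsEquivMuZhatFund_mem_cycIsoClass, fun ζ => ?_⟩
    rw [hcomp, MulEquiv.inv_apply]
    -- `(inv ∘ E_Q) (Λ(f_M) ζ) = E_Q (Λ(f_M) ζ⁻¹)` definitionally
    have key := cyclotomeUnitsEquivMuZhatFund_canonical_restrict f π ϖ j hM φ haug hφM h₁ h₂ ζ⁻¹
    rw [map_inv] at key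
    exact key

include hM haug hφM in
/-- The converse direction: every member `e₂` of THE class of `ϖ` is `μ_Ẑ(β) ∘ e₁ ∘` (inverse of `Λ(f_M)` on its
image) for some member `e₁` of THE class of `π` — `e₂ ∘ Λ(f_M) = μ_Ẑ(β) ∘ e₁`.
[cite: MochizukiAbsTopIII2015, Proposition 3.3 (i) p.73] -/
theorem unitKummerTheoryMuZhatFund_cycIsoClass_restrict' (h₁ : IsOpenMap π.D.aug) (h₂ : IsOpenMap ϖ.D.aug) :
    ∀ e₂ ∈ ϖ.unitKummerTheoryMuZhatFund.cycIsoClass, ∃ e₁ ∈ π.unitKummerTheoryMuZhatFund.cycIsoClass,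
      ∀ ζ : cyclotome P.M,
        e₂ (EtaleTheta.cyclotome.map (Units.map f.homM) ζ) = φ.muZhatMap h₁ h₂ (e₁ ζ) := by
  intro e₂ he₂
  obtain ⟨u, hu, hcomp⟩ := ϖ.unitKummerTheoryMuZhatFund.cycIsoClass_torsor _
    ϖ.trans_cyclotomeUnitsEquivMuZhatFund_mem_cycIsoClass e₂ he₂
  rcases hu rfl with rfl | rfl
  · refine ⟨_, π.trans_cyclotomeUnitsEquivMuZhatFund_mem_cycIsoClass, fun ζ => ?_⟩
    rw [hcomp, MulEquiv.refl_apply]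
    exact cyclotomeUnitsEquivMuZhatFund_canonical_restrict f π ϖ j hM φ haug hφM h₁ h₂ ζ
  · refine ⟨_, π.inv_trans_cyclotomeUnitsEquivMuZhatFund_mem_cycIsoClass, fun ζ => ?_⟩
    rw [hcomp, MulEquiv.inv_apply]
    -- `(inv ∘ E_P) ζ = E_P ζ⁻¹` definitionally
    have key := cyclotomeUnitsEquivMuZhatFund_canonical_restrict f π ϖ j hM φ haug hφM h₁ h₂ ζ⁻¹
    rw [map_inv] at key
    exact key

end GaloisMonoidPair.TLGPresentation

/-! ### §4 The genuine instance: `E/F` finite, the Galois models on Mathlib's algebraic closures -/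

section Genuine

open Literature.NumberTheory.GaloisRepresentations

variable (F E : Type) [Field F] [ValuativeRel F] [TopologicalSpace F] [IsNonarchimedeanLocalField F] [CharZero F]
  [Field E] [ValuativeRel E] [TopologicalSpace E] [IsNonarchimedeanLocalField E] [CharZero E]
  [Algebra F E] [FiniteDimensional F E] [ValuativeExtension F E]

/-- **THE junctions of `(E, E^alg)` and `(F, F^alg)` intertwine `Λ(ι⁻¹)` with `μ_Ẑ(res)`, HYPOTHESIS-FREE**, for
every finite extension `E/F` of non-archimedean local fields of characteristic `0` (valuation prolonging): along
the GENUINE restriction morphism `restrictHom F E : (G_E ↷ 𝒪_Ē^⊳) → (G_F ↷ 𝒪_F̄^⊳)` (object component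
`ι⁻¹ = (absClosureEquiv F E)⁻¹`, Galois component abc-iut's `absGaloisRestrict F E`),
`junction_F (Λ(ι⁻¹) ξ) = μ_Ẑ(res) (junction_E ξ)` for every `ξ ∈ Λ((E^alg)ˣ)` — §1 at the witness; in
particular §1's hypotheses are inhabited by every genuine `E ⊋ F`.
[cite: MochizukiAbsTopIII2015, Proposition 3.3 (i) p.73] [cite: MochizukiAbsAnab2004, Prop 1.2.1 (vii) p.11] -/
theorem cyclotomeUnitsEquivMuZhatFund_map_restrictHom (ξ : EtaleTheta.cyclotome (AlgebraicClosure E)ˣ) :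
    (MLFClosure.ofAlgClosure F).cyclotomeUnitsEquivMuZhatFund
        (EtaleTheta.cyclotome.map
          (Units.map ((absClosureEquiv F E).symm : AlgebraicClosure E →* AlgebraicClosure F)) ξ) =
      (restrictHom F E).muZhatMap (C₁ := MLFClosure.ofAlgClosure E) (C₂ := MLFClosure.ofAlgClosure F)
        (ModelMLFGaloisData.galois_aug_isOpenMap E (AlgebraicClosure E))
        (ModelMLFGaloisData.galois_aug_isOpenMap F (AlgebraicClosure F))
        ((MLFClosure.ofAlgClosure E).cyclotomeUnitsEquivMuZhatFund ξ) :=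
  GaloisMonoidPair.Hom.cyclotomeUnitsEquivMuZhatFund_map_restrict (C₁ := MLFClosure.ofAlgClosure E)
    (C₂ := MLFClosure.ofAlgClosure F) ((absClosureEquiv F E).symm) (restrictHom F E) (restrictHom_haug F E)
    (restrictHom_hφM F E) _ _ ξ

/-- … and inverted: `junction_F⁻¹ (μ_Ẑ(res) η) = Λ(ι⁻¹) (junction_E⁻¹ η)` for every `η ∈ μ_Ẑ(G_E)`, hypothesis-free.
[cite: MochizukiAbsTopIII2015, Remark 3.2.1 p.73] -/
theorem cyclotomeUnitsEquivMuZhatFund_symm_muZhatMap_restrictHom (η : muZhat (absoluteGaloisGroup E)) :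
    (MLFClosure.ofAlgClosure F).cyclotomeUnitsEquivMuZhatFund.symm
        ((restrictHom F E).muZhatMap (C₁ := MLFClosure.ofAlgClosure E) (C₂ := MLFClosure.ofAlgClosure F)
          (ModelMLFGaloisData.galois_aug_isOpenMap E (AlgebraicClosure E))
          (ModelMLFGaloisData.galois_aug_isOpenMap F (AlgebraicClosure F)) η) =
      EtaleTheta.cyclotome.map
        (Units.map ((absClosureEquiv F E).symm : AlgebraicClosure E →* AlgebraicClosure F))
        ((MLFClosure.ofAlgClosure E).cyclotomeUnitsEquivMuZhatFund.symm η) :=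
  GaloisMonoidPair.Hom.cyclotomeUnitsEquivMuZhatFund_symm_muZhatMap (C₁ := MLFClosure.ofAlgClosure E)
    (C₂ := MLFClosure.ofAlgClosure F) ((absClosureEquiv F E).symm) (restrictHom F E) (restrictHom_haug F E)
    (restrictHom_hφM F E) _ _ η

end Genuine

end Literature.AnabelianGeometry.AbsoluteAnabelian

end
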